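import Literature.NumberTheory.EllipticCurves.RohrlichAnticyclotomicNonvanishing
import Literature.NumberTheory.GaloisRepresentations.HeckeCharacterConductorExponent
import Literature.NumberTheory.GaloisRepresentations.HeckeCharacterProofs
import Literature.NumberTheory.Automorphic.AdeleBaseChange
import Literature.NumberTheory.LFunctions.KroneckerCharacter
import Literature.NumberTheory.QuadraticFields.QuadraticDedekindZeta
import HarnessLib

/-!
# Burungale–Skinner–Tian–Wan (arXiv:2409.01350v2, PREPRINT), Appendix B "Values of Hecke characters",
# §B.2 "An auxiliary result": the family `𝔛` of self-dual Hecke characters (i)–(viii), the field of values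
# `F_ψ`, and Lemma B.2 (`L ∉ {ℚ(√−1), ℚ(√−2)} ⟹ ⋂_{ψ ∈ 𝔛} F_ψ = ℚ`) — the device by which the unit `u_L`
# of the Perrin-Riou formula is shown to lie in `ℤ_(p)^×` (§7.2.1)

Seat `bsd-stepL-ty-snf` (typer; director-bsd (622)(3), pen bsd-stepL-plan g51, brief `TY-SNF-BRIEF-g51.md`
rev 7, T2/T4). Sibling of `AuxiliaryNewformSupplyPRE.lean` (Prop. 5.23 and the oriented CM supply, whose `λ`
ranges over the sub-family `𝔛′ ⊂ 𝔛` of the proof of Lemma B.2). Consumer context: crux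
`ErratumRoadFive.EulerHalfNotRamNoInertSetAtFive` (stmt-BirchSwinnertonDyer-19715) / aside
`KatoValuationIneqNonsplitAtFive` (stmt-…-33169); the idea-9 NF Sketch
(`Cruxes/EulerHalfNotRamNoInertSetAtFive/Lines/bdv_calibration_split_nf_Sketch.lean` rev 1.1) cites Lemma B.2
for `u_L ∈ ℤ_(p)^×` (§F O2) and builds `‖u_L‖_p = 1` into `NFCalibratorDatum.rhs`. Conventions of this
directory: UNREFEREED preprint ⇒ labelled binders `def … : Prop` with `[claim: …, status: under-review]` and
the printed locator, NEVER a theorem, no `_holds`; nothing asserted. Definitions WITH bodies: the membership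
predicate `IsInAuxFamilyB p L K ψ` (a `def` conjunction — no `structure`, no instance) and the value field
`finiteValueField ψ`; ONE binder (Lemma B.2); two bookkeeping lemmas PROVED.

## Printed statements (arXiv:2409.01350v2; TeX of record `pub/bsd-eis/lit/src/bstw24-v2/main.tex`
## sha16 5926f035551c636d, absolute lines «l.N» (body-relative = N − 257); store text
## `paper:arxiv-2409.01350` = LaTeXML chunks in EXTRACTION numbering, where App. B is "§8", §B.2 = "§8.2",
## Lemma B.2 = "Lemma 8.2", chunk p0066 L43–p0067; printed numbers from `LABELS-bstw24-v2.tsv`)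

* App. B head (l.6430–6439): "In the proof of the Perrin-Riou Conjecture given in §7 it is necessary to show
  that a certain constant – `u_L` in the notation of the proof – belongs to `ℚ`. This is achieved by appealing
  to Theorem A.1 and by knowing that is possible to choose suitable Hecke characters `ψ` whose values generate
  disjoint fields. … Recall that a Hecke chararacter `ψ : K^×\𝔸_K^× → ℂ^×` has infinity type `(−1,0)` if
  `ψ(z) = z^{−1}` for all `z ∈ (K ⊗ ℝ)^× = ℂ^×`. For such a character, the values `ψ(𝔸_K^{∞,×})` generate a
  finite extension `F_ψ ⊂ ℂ` of `ℚ`."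
* **§B.2** (label `B-auxiliary`, l.6532–6546; PDF pp. 76–77). "Suppose `p > 2` is a fixed prime and `L` is a
  fixed imaginary quadratic field of discriminant `−D_L < 0`[.] Consider the set `𝔛` of Hecke characters
  `ψ : K^×\𝔸_K^× → ℂ^×` of varying imaginary quadratic fields such that (i) the prime `p` splits in `K`;
  (ii) the discriminant `−D_K` of `K` is odd; (iii) the infinity type of `ψ` is `(−1,0)`;
  (iv) `ψ|_{𝔸^×} = χ_K|·|^{−1}`; (v) `𝔣_ψ = 𝔡_K 𝔣` with `(𝔡_K, 𝔣) = 1`; (vi) the root number `w(ψ)` of `ψ` is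
  `−1`; (vii) every prime dividing `D_K N_{K/ℚ}(𝔣_ψ)` splits in `L`; (viii) `ord_{s=1} L(s, ψ) = 1`. Note that
  conditions (i)-(vi) imply that Theorem A.1 holds for `ψ`".
* **Lemma B.2** (label `B-aux-lem`, l.6548–6549). "If `L ≠ ℚ(√−1), ℚ(√−2)`, then `⋂_{ψ ∈ 𝔛} F_ψ = ℚ`."
  Proof (l.6551–6608): an explicit sub-family `𝔛′ = {ψχ : ψ ∈ 𝔛_K^{can}, χ ∈ 𝔛(K, ℓ), K ∈ 𝔎, ℓ ∈ 𝔖(K)}`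
  (canonical characters of `K = ℚ(√−q)`, `q ≡ 3 mod 8`, `−q` a square mod `p`, `−D_L` a square mod `q`;
  anticyclotomic twists of `ℓ`-power order and conductor with `ord_{s=1} L(s, ψχ) = 1` by Rohrlich [Ro]),
  `F_{ψχ} ⊂ F_ψ(μ_{ℓ^∞})`, Prop. B.1 (`⋂_{ψ ∈ 𝔛_K^{can}} F_ψ = K` for `h_K` odd), and `⋂_{K ∈ 𝔎} K = ℚ`.
* §7.2.1, "Proof that `u_L ∈ ℤ_(p)^×`" (l.6177–6183): "Theorem A.1 applies to the CM forms associated with the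
  characters `ψ ∈ 𝔛` … It then follows from comparing Theorem A.1 with (7.5) [label up-to-uL] for `g = g_ψ`
  that `u_L ∈ F_ψ^×` for all `ψ ∈ 𝔛`. In particular, `u_L ∈ ⋂_{ψ ∈ 𝔛} F_ψ`. The latter equals `ℚ` by Lemma
  B.2. This shows that `u_L ∈ ℚ^× ∩ ℤ_p^{ur,×} = ℤ_(p)^×`." (There, l.6148: "we can and do assume that
  `L ≠ ℤ(√−1), ℚ(√−2)`".)
* App. A (l.6286–6292): "(A-psi-res) `ψ|_{𝔸^×} = χ_K|·|^{−1}` … This implies that `g` [= `g_ψ`] has trivial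
  Nebentypus. In particular, `g ∈ S₂(Γ₀(N))` is a newform of level `N = D_K N_{K/ℚ}(𝔣_ψ)`."
  (A-BDP2-hyp) (l.6382–6383): "`D_K` is odd and `𝔡_K` exactly divides `𝔣_ψ`" = (ii) + (v).

## Transcription (idelic; every notion is the tree's `GaloisRepresentations.HeckeCharacter` dictionary, the
## SAME one used for the same characters by `RohrlichAnticyclotomicNonvanishing.lean`)

* "`K` imaginary quadratic", "`p` splits in `K`": `IsImaginaryQuadratic K`, `SatisfiesHeegnerHypothesis p K`
  (`HeegnerPoints.lean`: exactly two primes of `𝓞 K` above `p`). (ii) "`−D_K` odd": `Odd (NumberField.discr K)`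
  (`discr K = −D_K`).
* (iii) "infinity type `(−1,0)`, i.e. `ψ(z) = z^{−1}` on `(K ⊗ ℝ)^× = ℂ^×`" (idelic, l.6438): the tree's
  `ψ.HasInfinityType (fun _ ↦ 1) (fun _ ↦ 0)` — by definition `ψ((z, 1)) = ι_w(z)^{−1}` at the unique infinite
  place `w` (`HeckeCharacter.HasInfinityType`, Serre–Weil sign convention `A_{p,q}(z) = ι_w(z)^{−p} ι̅_w(z)^{−q}`),
  which is LITERALLY BSTW's condition, with Mathlib's embedding of `w` in the role of BSTW's `ι_∞`
  (`RohrlichAnticyclotomicNonvanishing.lean`, "Transcription", calls the same characters "type `(1,0)`" in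
  the ideal-theoretic language `φ((α)) = α`; replacing `ι_∞` by its conjugate replaces `𝔛` by `{ψ ∘ c}`, which
  has the same value fields, `L`-functions and root numbers, so Lemma B.2 is insensitive to the choice).
* (iv) "`ψ|_{𝔸^×} = χ_K|·|^{−1}`" (restriction to the ideles of `ℚ`; `χ_K` the quadratic idele class character
  of `K/ℚ`, "identified by the reciprocity map", §2.5.1 l.1819–1820; `|·|` the idele norm): for every idele `x`
  of `ℚ`, `ψ(x_K) = χ_K(x)·‖x‖^{−1}` with `x_K = AdeleRing.ideleBaseChange ℚ K x` (`Automorphic/AdeleBaseChange`),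
  `χ_K = HeckeCharacter.ofDirichlet (kroneckerChar d_K)` (the tree's Hecke character of the primitive quadratic
  Dirichlet character of `K`, normalised `ψ_χ(ϖ_ℓ) = χ(ℓ)`; `χ_K` is quadratic, so the normalisation of the
  dictionary is immaterial) and `‖x‖ = ideleNorm x`. Consistency check at the infinite place: for `r ∈ ℝ^× ⊂ ℂ^×`
  both sides are `r^{−1}` (`χ_K` is odd).
* (v) "`𝔣_ψ = 𝔡_K 𝔣` with `(𝔡_K, 𝔣) = 1`" (the different `𝔡_K` divides the conductor EXACTLY): under (ii) the
  different of `K` is squarefree (odd discriminant: tame ramification, exponent `e − 1 = 1` at each ramified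
  prime), so (v) says: at every prime `v` of `𝓞 K` dividing `𝔡_K = differentIdeal ℤ (𝓞 K)` (Mathlib) the
  conductor exponent of `ψ` is exactly `1` (`HeckeCharacter.HasConductorExponentAt ψ v 1`,
  `HeckeCharacterConductorExponent.lean`, Li–Xu §2.1.1 / Tate §2.3). Stated in this form (faithful given (ii),
  which is part of the same conjunction).
* (vi) "`w(ψ) = −1`": `IsCentralRootNumber ψ (−1)` (`RohrlichAnticyclotomicNonvanishing.lean`: there are `B > 0`
  and an entire `Λ` with `Λ(s) = Γ(s)B^s L(s, ψ)` on `re s > 3/2` and `Λ(s) = −Λ(2 − s)`; weight-two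
  normalisation, centre `s = 1`, as in (viii)).
* (vii) "every prime dividing `D_K N_{K/ℚ}(𝔣_ψ)` splits in `L`": every rational prime `ℓ` with `ℓ ∣ d_K` or
  below a place where `ψ` is ramified (`¬ ψ.IsUnramifiedAt v`, `(ℓ : 𝓞 K) ∈ v`) satisfies
  `SatisfiesHeegnerHypothesis ℓ L`.
* (viii) "`ord_{s=1} L(s, ψ) = 1`": `HasSimpleCentralZero ψ` (ibid.: an entire continuation of the tree's
  `heckeLFunction ψ` from `re s > 3/2` has `F(1) = 0 ≠ F′(1)`).
* "`F_ψ` = the extension of `ℚ` generated by `ψ(𝔸_K^{∞,×})`": `finiteValueField ψ` = the subfield of `ℂ`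
  generated by the values of `ψ` on the ideles with trivial infinite component (Mathlib's
  `AdeleRing = InfiniteAdeleRing × FiniteAdeleRing`).
* "`⋂_{ψ ∈ 𝔛} F_ψ = ℚ`", `𝔛` ranging over characters of VARYING fields `K`: every `z ∈ ℂ` lying in `F_ψ` for
  all `(K, ψ)` with `ψ ∈ 𝔛` is rational (the inclusion `ℚ ⊆ ⋂ F_ψ` being trivial). VACUITY NOTE: the typed
  statement is as strong as print only because `𝔛 ≠ ∅` (indeed infinite, proof of Lemma B.2); were a clause of
  `IsInAuxFamilyB` mis-transcribed into an unsatisfiable one, the binder would become FALSE (not vacuous) —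
  reviewers please check (iii)/(iv)/(vi) against the sibling transcription of the same characters in
  `RohrlichAnticyclotomicNonvanishing.lean`.

## What is here / what is NOT here (and why)

* Definitions with bodies: `finiteValueField`, `IsInAuxFamilyB`. Binder: `lemmaB2_auxFamily_valueFields_inter_eq_rat_PRE`.
  Proved: `finiteValueField_ratCast_mem` (`ℚ ⊆ F_ψ`), `IsInAuxFamilyB.odd_discr`-style projections are left to
  `And` destructuring (no API needed).
* NOT here: the canonical characters `𝔛_K^{can}` and Prop. B.1 (`⋂ F_ψ = K` for `h_K` odd) — upstream of
  Lemma B.2 only, not consumed by the Sketch; the set `𝔔` and its infinitude (Dirichlet), the sub-family `𝔛′`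
  — inside the proof; Theorem A.1 (App. A, the CM Perrin-Riou formula `log_BK^η(loc_p z_{γ′}(g)) =_{F_ψ^×}
  Ω_p^{−1} log_ω(P_ψ)²`) and the unit `u_L` itself (`U_L = 𝒰_L^{−1} mod (γ_+ − 1)`, `𝒰_L = T_v^{−1}ℋ_v·η_{𝐡_v}(…)`,
  Lemma 5.30) — no tree carrier for the Bloch–Kato logarithm on `V_g(1)`, the congruence power series `ℋ_v`
  or the `Λ_L`-adic CM family (litref TYPER-SHEET-bstw24-v1 §A.3); in the consumer's Sketch this is exactly
  the posited interface `NFPort` (D3) and the norm-form identity `BstwIntegralPerrinRiouNF`, where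
  `‖u_L‖_p = 1` is built in. Rohrlich's theorem: tree fact `RohrlichJia_centralOrder_anticyclotomicTwists`.

## References

* [BurungaleSkinnerTianWan2024] arXiv:2409.01350v2 (PREPRINT): App. B head (l.6430–6439), §B.2 (B-auxiliary,
  l.6532–6546), Lemma B.2 (B-aux-lem, l.6548) and proof (l.6551–6608), §7.2.1 (l.6148, l.6177–6183), App. A
  (A-psi-res) l.6288, (A-BDP2-hyp) l.6382, §2.5.1 l.1819–1820.
* [Jia2026ActaArith] / [Rohrlich1984Anticyclotomic] — the non-vanishing input (tree).
* [LiXu2026] §2.1.1, [TateThesis1967] §2.3 — conductor exponents (tree).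
-/

noncomputable section

open NumberField IsDedekindDomain
open Literature.NumberTheory.GaloisRepresentations Literature.NumberTheory.Automorphic
  Literature.NumberTheory.LFunctions.KroneckerCharacter

namespace Literature.NumberTheory.EllipticCurves.BurungaleSkinnerTianWan2024

section Definitions

variable {K : Type} [Field K] [NumberField K]

/-- **The field of values `F_ψ ⊂ ℂ` of a Hecke character on the finite ideles** (BSTW App. B, l.6438:
"the values `ψ(𝔸_K^{∞,×})` generate a finite extension `F_ψ ⊂ ℂ` of `ℚ`"): the subfield of `ℂ` generated by
the values `ψ(x)` at the ideles `x` whose infinite component is `1` (Mathlib: an adele is a pair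
(infinite adele, finite adele)). Finiteness over `ℚ` (for `ψ` of type `(−1,0)`) is NOT asserted.
[claim: BurungaleSkinnerTianWan2024, status: under-review]
[cite: BurungaleSkinnerTianWan2024, App. B (l.6438: F_ψ) and §4.1.2 (label Hecke-char, l.2644–2648)] -/
def finiteValueField (ψ : HeckeCharacter K) : Subfield ℂ :=
  Subfield.closure
    ((fun x : ideleGroup K ↦ ((ψ x : ℂˣ) : ℂ)) '' {x : ideleGroup K | (x : AdeleRing (𝓞 K) K).1 = 1})

/-- `ℚ ⊆ F_ψ` ("a finite extension `F_ψ ⊂ ℂ` of `ℚ`", App. B l.6438): every subfield of `ℂ` contains the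
rationals — the trivial inclusion of Lemma B.2. [cite: BurungaleSkinnerTianWan2024, App. B (TeX l.6438) and Lemma B.2 (label B-aux-lem, l.6548)] -/
theorem finiteValueField_ratCast_mem (ψ : HeckeCharacter K) (q : ℚ) : (q : ℂ) ∈ finiteValueField ψ := by
  exact SubfieldClass.ratCast_mem (finiteValueField ψ) q

end Definitions

/-- **Membership in BSTW's auxiliary family `𝔛 = 𝔛(p, L)`** (App. B §B.2, label `B-auxiliary`, l.6533–6545):
for a prime `p > 2` and an imaginary quadratic field `L`, the pair (`K`, `ψ : K^×\𝔸_K^× → ℂ^×`) belongs to `𝔛`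
iff `K` is imaginary quadratic and "(i) the prime `p` splits in `K`; (ii) the discriminant `−D_K` of `K` is
odd; (iii) the infinity type of `ψ` is `(−1,0)`; (iv) `ψ|_{𝔸^×} = χ_K|·|^{−1}`; (v) `𝔣_ψ = 𝔡_K𝔣` with
`(𝔡_K, 𝔣) = 1`; (vi) the root number `w(ψ)` of `ψ` is `−1`; (vii) every prime dividing `D_K N_{K/ℚ}(𝔣_ψ)` splits
in `L`; (viii) `ord_{s=1} L(s, ψ) = 1`." Transcription clause by clause in the module docstring: (iii) =
`HasInfinityType (1,0)` of the tree (= `ψ((z,1)) = z^{−1}`, literally BSTW's `ψ(z) = z^{−1}`); (iv) on the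
base change of every idele of `ℚ` with `χ_K = ofDirichlet (kroneckerChar d_K)` and the idele norm; (v) as
"conductor exponent exactly `1` at every prime dividing the different" (faithful under (ii): `𝔡_K`
squarefree); (vi) `IsCentralRootNumber ψ (−1)`; (viii) `HasSimpleCentralZero ψ`. A PREDICATE (explicit
binders; holds for the infinite sub-family `𝔛′` of the proof of Lemma B.2, fails for others); no structure,
no instance. "Note that conditions (i)-(vi) imply that Theorem A.1 holds for `ψ`" (l.6546) is NOT encoded.
[claim: BurungaleSkinnerTianWan2024, status: under-review]
[cite: BurungaleSkinnerTianWan2024, App. B §B.2 (label B-auxiliary, TeX l.6533–6545: the set 𝔛, (i)–(viii)); App. A (A-psi-res) l.6288, (A-BDP2-hyp) l.6382] -/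
def IsInAuxFamilyB (p : ℕ) (L : Type) [Field L] [NumberField L] (K : Type) [Field K] [NumberField K]
    (ψ : HeckeCharacter K) : Prop :=
  IsImaginaryQuadratic K ∧
  -- (i) `p` splits in `K`
  SatisfiesHeegnerHypothesis p K ∧
  -- (ii) `−D_K` is odd
  Odd (NumberField.discr K) ∧
  -- (iii) infinity type `(−1,0)`: `ψ(z) = z⁻¹` on `(K ⊗ ℝ)ˣ = ℂˣ`
  ψ.HasInfinityType (fun _ ↦ 1) (fun _ ↦ 0) ∧
  -- (iv) `ψ|_{𝔸_ℚ^×} = χ_K |·|⁻¹`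
  (∀ x : ideleGroup ℚ,
    ((ψ (AdeleRing.ideleBaseChange ℚ K x) : ℂˣ) : ℂ) =
      ((HeckeCharacter.ofDirichlet (kroneckerChar (NumberField.discr K)) x : ℂˣ) : ℂ) *
        ((ideleNorm x : ℝ) : ℂ)⁻¹) ∧
  -- (v) `𝔣_ψ = 𝔡_K 𝔣` with `(𝔡_K, 𝔣) = 1`: conductor exponent exactly `1` at the primes of the different
  (∀ v : HeightOneSpectrum (𝓞 K), v.asIdeal ∣ differentIdeal ℤ (𝓞 K) → ψ.HasConductorExponentAt v 1) ∧
  -- (vi) root number `w(ψ) = −1`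
  IsCentralRootNumber ψ (-1) ∧
  -- (vii) every prime dividing `D_K · N(𝔣_ψ)` splits in `L`
  (∀ ℓ : ℕ, ℓ.Prime →
    ((ℓ : ℤ) ∣ NumberField.discr K ∨
      ∃ v : HeightOneSpectrum (𝓞 K), (ℓ : 𝓞 K) ∈ v.asIdeal ∧ ¬ ψ.IsUnramifiedAt v) →
    SatisfiesHeegnerHypothesis ℓ L) ∧
  -- (viii) `ord_{s=1} L(s, ψ) = 1`
  HasSimpleCentralZero ψ

/-! ### Lemma B.2 -/

/-- **OPEN BINDER — UNREFEREED PREPRINT (arXiv:2409.01350v2), Lemma B.2 (label `B-aux-lem`, TeX l.6548;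
extraction "Lemma 8.2", chunk p0066 L67).** Standing (§B.2, l.6533): "`p > 2` is a fixed prime and `L` is a
fixed imaginary quadratic field of discriminant `−D_L < 0`". "**Lemma B.2.** If `L ≠ ℚ(√−1), ℚ(√−2)`, then
`⋂_{ψ ∈ 𝔛} F_ψ = ℚ`." — `𝔛 = 𝔛(p, L)` the family of `IsInAuxFamilyB p L` (characters of VARYING imaginary
quadratic `K`), `F_ψ = finiteValueField ψ`. Transcribed as: every complex number lying in `F_ψ` for every
`(K, ψ)` in `𝔛` is rational (`ℚ ⊆ ⋂ F_ψ` is automatic, `finiteValueField_ratCast_mem`); "`L ≠ ℚ(√−1),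
ℚ(√−2)`" = `d_L ∉ {−4, −8}`. Use in print: §7.2.1 l.6177–6183, `u_L ∈ ⋂_{ψ∈𝔛} F_ψ = ℚ`, whence
`u_L ∈ ℚ^× ∩ ℤ_p^{ur,×} = ℤ_(p)^×`. Proof in print: Prop. B.1 (canonical characters of `ℚ(√−q)`, Kummer
theory), anticyclotomic twists and Rohrlich's theorem (tree: `RohrlichJia_centralOrder_anticyclotomicTwists`),
`F_{ψχ} ⊂ F_ψ(μ_{ℓ^∞})`. Nothing asserted; NEVER cite this `Prop` as a theorem. See the VACUITY NOTE of the
module docstring (the statement is false, not vacuous, if `𝔛` were empty).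
[claim: BurungaleSkinnerTianWan2024, status: under-review]
[cite: BurungaleSkinnerTianWan2024, Lemma B.2 (label B-aux-lem, TeX l.6548–6549; proof l.6551–6608) with §B.2 l.6533 (standing p > 2, L) and §7.2.1 l.6177–6183 (use: u_L ∈ ℤ_(p)^×)] -/
def lemmaB2_auxFamily_valueFields_inter_eq_rat_PRE : Prop :=
  ∀ (p : ℕ) [Fact p.Prime], p ≠ 2 → ∀ (L : Type) [Field L] [NumberField L], IsImaginaryQuadratic L →
    NumberField.discr L ≠ -4 → NumberField.discr L ≠ -8 →
    ∀ z : ℂ,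
      (∀ (K : Type) [Field K] [NumberField K] (ψ : HeckeCharacter K),
          IsInAuxFamilyB p L K ψ → z ∈ finiteValueField ψ) →
      z ∈ Set.range ((↑) : ℚ → ℂ)

/-! ### Bookkeeping (proved) -/

/-- Clauses (ii) and (v) of `𝔛` are BSTW's hypothesis (A-BDP2-hyp) of Theorem A.1 ("`D_K` is odd and `𝔡_K`
exactly divides `𝔣_ψ`"), clause (iv) is (A-psi-res) and clause (i) is (A-split): the projections, for
consumers matching `𝔛` against App. A. [cite: BurungaleSkinnerTianWan2024, App. B l.6546 ("conditions (i)-(vi) imply that Theorem A.1 holds for ψ") with App. A (A-split) l.6311, (A-psi-res) l.6288, (A-BDP2-hyp) l.6382] -/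
theorem IsInAuxFamilyB.appA_hypotheses {p : ℕ} {L : Type} [Field L] [NumberField L] {K : Type} [Field K]
    [NumberField K] {ψ : HeckeCharacter K} (h : IsInAuxFamilyB p L K ψ) :
    SatisfiesHeegnerHypothesis p K ∧ Odd (NumberField.discr K) ∧
      (∀ x : ideleGroup ℚ,
        ((ψ (AdeleRing.ideleBaseChange ℚ K x) : ℂˣ) : ℂ) =
          ((HeckeCharacter.ofDirichlet (kroneckerChar (NumberField.discr K)) x : ℂˣ) : ℂ) *
            ((ideleNorm x : ℝ) : ℂ)⁻¹) ∧
      (∀ v : HeightOneSpectrum (𝓞 K), v.asIdeal ∣ differentIdeal ℤ (𝓞 K) →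
        ψ.HasConductorExponentAt v 1) :=
  ⟨h.2.1, h.2.2.1, h.2.2.2.2.1, h.2.2.2.2.2.1⟩

/-- Granted Lemma B.2: an element of `ℂ` common to all `F_ψ`, `ψ ∈ 𝔛(p, L)`, which is ALSO known to be a
`p`-adic unit "`∈ ℤ_p^{ur,×}`" in whatever sense the consumer carries, is a rational number — the shape of
the sentence "`u_L ∈ ℚ^× ∩ ℤ_p^{ur,×} = ℤ_(p)^×`" (§7.2.1 l.6183); here only the rationality half, the
`p`-integrality being the consumer's own datum. [cite: BurungaleSkinnerTianWan2024, §7.2.1 (TeX l.6177–6183)] -/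
theorem exists_rat_eq_of_mem_valueFields (h : lemmaB2_auxFamily_valueFields_inter_eq_rat_PRE) (p : ℕ)
    [Fact p.Prime] (hp : p ≠ 2) (L : Type) [Field L] [NumberField L] (hL : IsImaginaryQuadratic L)
    (h4 : NumberField.discr L ≠ -4) (h8 : NumberField.discr L ≠ -8) (u : ℂ)
    (hu : ∀ (K : Type) [Field K] [NumberField K] (ψ : HeckeCharacter K),
      IsInAuxFamilyB p L K ψ → u ∈ finiteValueField ψ) :
    ∃ q : ℚ, (q : ℂ) = u := by
  obtain ⟨q, hq⟩ := h p hp L hL h4 h8 u hu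
  exact ⟨q, hq⟩

end Literature.NumberTheory.EllipticCurves.BurungaleSkinnerTianWan2024

end
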